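import Summits.QuantumFields.YangMills.Theorems.BalabanUVNodesN08AlphaEq324RowACReMassedSlot
import Summits.QuantumFields.YangMills.Theorems.BalabanUVNodesN08SlotOfRecordFromAlphaACMassBoundAE

/-!
# Route «BalabanUVNodes», Track-A DAG node N08 = [Balaban1985UV3] Thm 1 p. 257 ∕ Thm 2 p. 272 — THE RE-MASSED AC TOWER READ FROM THE EDITED (α)-AC CLAUSE, part 3:
# N08's SLOT OF RECORD `Node00.PrintedUV3V N L` from `…RowAC.RunAlphaEq324CoreLTAtAC` (the (3.24) row in print's output-sandwich currency at ANY cumulant letter, range-honest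
# bundle) AND A `dU`-a.e. EXTENSIVE MASS BOUND (dag-n08-w1 g4's III-b `…N08SlotOfRecordFromAlphaACMassBoundAE` re-entered one (α)-currency lower)

Cell `pub-ymgap`, seat `pub-ymgap-dag-n08-w4` gen 4 (INTENT-3, file 3; sequel of `…RowACReMassedSlot`).  `bears_on: R4∕N08`; `--supports stmt-QuantumFields-20542` (K1⁷, helper).
THEOREMS ONLY (def-free), sorry-free, standard axioms; dag-n08-w1's files 14∕17∕III-a∕III-b and the lane's `Balaban3D/Proofs/*AC` modules consumed BY NAME, untouched.

WHAT THIS FILE PROVES (dag-n08-w1's III-b proofs verbatim with `RunAlphaAC ↦ RunAlphaEq324CoreLTAtAC … (c S)` and part 2's `nonempty_analyticLeaves_reMassed_of_coreLTAtAC`):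
* §1 ★★ `printedUV3G_at_record_of_coreLTAtAC_of_reMassed_of_window` — the printed pair at the record's binders along re-massed AC inputs, given the window.
* §2 ★★★ `printedUV3V_at_slotOfRecord_of_coreLTAtAC_of_massBoundAE_of_consts` — **`Node00.PrintedUV3V N L` ⟸ (on `Family L (eps0Of γ₀)`) the EDITED (α)-AC rows at print's own
  averaging pinned to the record (the (3.24) row as the printed SANDWICH `Eq324` at ANY letter `c S k`, range-honest bundle `𝔄 S : AlphaDataLTAC`) ∧ «`massRecAC … k h ≤
  e^{c_m|T₁^{(k)}|}` `dU_k`-a.e., `1 ≤ k ≤ K`» ∧ `b₀p₀^{p₀}e^{1−p₀} ≤ εbg`** (the re-massing `min (massRecAC) (e^{c_k})` chosen inside the proof, as in III-b); ★★★ `…_of_consts'` (A6 ∃X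
  form along file 9 §2's inhabitant); ★★★ `…_of_weakClosed_of_consts'` (composed with file 17 §3: the mass bound from a density bound on ANY weakly-closed family at print's averaging);
  ★ `printedUV3V_at_slotOfRecord_of_alphaAC_of_massBoundAE_of_consts_via_eq324` (III-b's RunAlphaAC form recovered as the χ-letter instance through `coreLTAtAC_cum_of_runAlphaAC`).
LOCATED READING (R-AC-324⁶; count-neutral, owners decide).  N08's residual on the road of record in AC currency, in its weakest typed form: (i) the edited (α)-AC rows — G3D binders
«as cited», the displays, the identifications, G3D-02 and the printed (3.24) SANDWICH at the supplier's letter (the IDENT of B10's step block with a [BenfattoEtAl1978]∕class model =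
class II ∕ NODE 00), the transported residual pair, the class-I rows — ∧ (ii) ONE `dV`-a.e. density bound on a weakly-closed family at print's averaging (dag-n08-w1 (R4⁶); n08-w3∕w6
analysis) ∧ (iii) the free numeric window `b₀p₀^{p₀}e^{1−p₀} ≤ εbg`.  No tilted cgf-derivative bound, no all-steps binder, no E6′, no pointwise statement about a Radon–Nikodym version.
HONEST FRAMING: count-neutral helper; (i) and (ii) are HYPOTHESES = N08's object gap; `PrintedUV3V` NOT proved; N08 NOT discharged; counts unmoved; one finite 𝕋⁴ programme at fixed ε,
Bałaban AS PRINTED — R4 closes the conditional finite-𝕋⁴ rung `BalabanLadder.UV` only; the Yang–Mills mass gap (Clay) is NOT proved by any of this; nothing continuum ∕ ℝ⁴ ∕ OS.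

References: [Balaban1985UV3] T. Bałaban, Commun. Math. Phys. 102 (1985) 255–275 — Thm 1 p. 257, Thm 2 p. 272, (7) p. 257, (41) p. 266, pp. 256–274; [Balaban1985Averaging]
(15) p. 19; [Balaban1982Higgs1] (3.24) p. 616.
-/

noncomputable section

open MeasureTheory

namespace Summit.QuantumFields.YangMills.Theorems.BalabanUVNodesN08AlphaEq324RowACReMassedSlotOfRecord

open Literature.MathematicalPhysics.QuantumFieldTheory.Balaban1983to89
open Literature.MathematicalPhysics.QuantumFieldTheory.Balaban1983to89.Node00 (SU TFamily₃)
open Literature.MathematicalPhysics.QuantumFieldTheory.Balaban1983to89.B10RunsOfRecord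
open Literature.MathematicalPhysics.QuantumFieldTheory.Balaban1985CMP102
open Literature.MathematicalPhysics.QuantumFieldTheory.Balaban1985CMP102.Setting
open Literature.MathematicalPhysics.QuantumFieldTheory.Balaban1985CMP102.Theorems (Family)
open Summit.QuantumFields.Balaban3D
open Summit.QuantumFields.Balaban3D.Carriers (nblkOf StepSeries Hist rcolOf eps1Of epsSOf)
open Summit.QuantumFields.Balaban3D.Proofs
open Summit.QuantumFields.Balaban3D.Proofs.ScalesArithmetic (sites_nonneg)
open Summit.QuantumFields.Balaban3D.Proofs.Constants (eps0Of)
open Summit.QuantumFields.Balaban3D.Proofs.FamilyLE (le_of_eps0Of)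
open Summit.QuantumFields.Balaban3D.Proofs.GroupModelLieC (lieC)
open Summit.QuantumFields.Balaban3D.Proofs.TowerAC (HistWeightsAC TowerInputAC)
open Summit.QuantumFields.Balaban3D.Proofs.SeriesAC (TowerBaseAC)
open Summit.QuantumFields.Balaban3D.Proofs.StandardAC (ExternalInputsAC)
open Summit.QuantumFields.Balaban3D.Proofs.MassesAC (massRecAC massRecAC_nonneg massRecAC_zero one_le_massRecAC_triv measurable_massRecAC)
open Summit.QuantumFields.Balaban3D.Proofs.AlphaAC (AlphaDataAC RunAlphaAC)
open Summit.QuantumFields.YangMills.BalabanUVNodes.N08Thm2AsPrintedAtSlotOfRecordAC (exists_TFamily₃_of_av_eq exists_externalInputsAC_ofPrint)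
open Summit.QuantumFields.YangMills.BalabanUVNodes.N08Thm2AtRecordFromAlpha (window_of_famConsts pos_of_famConsts consts_adm_of_pos)
open Summit.QuantumFields.YangMills.BalabanUVNodes.N08SlotOfRecordFromAlphaAC (printedUV3G_of_analyticLeaves_towerAC3_of_window)
open Summit.QuantumFields.YangMills.BalabanUVNodes.N08ReMassedACLeaves (usesConsts_reMassed)
open Summit.QuantumFields.YangMills.BalabanUVNodes.N08MassesACLeastClosedFamily (massRecAC_le_exp_ae_of_weakClosed)
open Summit.QuantumFields.YangMills.BalabanUVNodes.N08Thm2AtRecordBridgeInhabited (avgAC_avOfPrint)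
open Summit.QuantumFields.YangMills.BalabanUVNodes.N08SlotOfRecordFromAlphaACMassBoundAE (printedUV3V_at_slotOfRecord_of_alphaAC_of_massBoundAE_of_consts)
open Summit.QuantumFields.YangMills.Theorems.BalabanUVNodesN08AlphaEq324RowAC
open Summit.QuantumFields.YangMills.Theorems.BalabanUVNodesN08AlphaEq324RowACReMassedSlot (nonempty_analyticLeaves_reMassed_of_coreLTAtAC)

variable {N : ℕ} [NeZero N] {L : ℕ} {𝔊 : GroupModel (SU N)} {𝔠 : Primitives.AlphaConsts L 𝔊.N} {εbg cm : ℝ}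
  {X : ∀ S : Scales L, ExternalInputsAC S (SU N)}
  {𝔖 : ∀ (S : Scales L) (k : ℕ), StepSeries S (SU N) ↥(lieC 𝔊) (nblkOf S 𝔠.lane.carrier k) k}
  {𝔄 : ∀ S : Scales L, AlphaDataLTAC 𝔊 𝔠 (X S) (𝔖 S)}
  {c : ∀ (S : Scales L) (k : ℕ), Hist S.P (k + 1) → GaugeField S.P (k + 1) (SU N) → ℕ → ℝ}

/-! ## §1 The printed pair at the record's binders along a family of re-massed AC inputs, from the edition -/

/-- ★★ **`PrintedUV3G` AT THE RECORD'S BINDERS ALONG RE-MASSED AC INPUTS FROM THE EDITED (α)-AC ROWS, GIVEN THE WINDOW** (file 14 §3 on part 2's bundles at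
`C′ = {𝔠.lane.consts with d := d + c_m}`; III-b §1 one (α)-currency lower). [cite: Balaban1985UV3, Thm 1 p.257 + Thm 2 p.272 + pp.256–274; Balaban1982Higgs1, (3.24) p.616] -/
theorem printedUV3G_at_record_of_coreLTAtAC_of_reMassed_of_window (W' : ∀ S : Scales L, HistWeightsAC S.P (SU N))
    (hUk : ∀ (S : Scales L) k (V : GaugeField S.P (k + 1) (SU N)), (X S).Uk k V = UkA N (fun S => (X S).av) S (k + 1) εbg V) (hpos : 0 < εbg)
    (hwin : ∀ S : Family L (eps0Of 𝔠.gamma0), eps1OfPrint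
        { eps0 := eps0Of 𝔠.gamma0,
          E := fun S => B10.Ek ((({ (X S).toTowerBase 𝔠.lane.carrier with W := W' S } : TowerBaseAC S (SU N)).withSeriesAC (𝔖 S)
            (Carriers.piecesParamsOf S 𝔠.lane.carrier)).Estep) S.K 0,
          b₀ := 𝔠.lane.F.b₀, p₀ := 𝔠.lane.F.p₀, εbg := εbg } S.1 0 ≤ εbg ∨ 2 < εbg)
    (R : ∀ S : Family L (eps0Of 𝔠.gamma0), RunAlphaEq324CoreLTAtAC 𝔊 𝔠 (X S.1) (𝔖 S.1) (𝔄 S.1) (c S.1)) (hcm : 0 ≤ cm)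
    (hae : ∀ S : Family L (eps0Of 𝔠.gamma0), ∀ j, j ≤ S.1.K → ∀ h : Hist S.1.P j, (W' S.1).mass j h =ᵐ[fieldMeasure S.1.P j (SU N)]
      massRecAC 𝔠.lane.carrier.M₁ (rcolOf S.1 𝔠.lane.carrier) (eps1Of S.1 𝔠.lane.carrier) (epsSOf S.1 𝔠.lane.carrier) (X S.1).av j h)
    (hdom : ∀ S : Family L (eps0Of 𝔠.gamma0), ∀ (j : ℕ) (h : Hist S.1.P j) (U : GaugeField S.1.P j (SU N)), (W' S.1).mass j h U ≤
      massRecAC 𝔠.lane.carrier.M₁ (rcolOf S.1 𝔠.lane.carrier) (eps1Of S.1 𝔠.lane.carrier) (epsSOf S.1 𝔠.lane.carrier) (X S.1).av j h U)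
    (hWm : ∀ S : Family L (eps0Of 𝔠.gamma0), ∀ (j : ℕ) (h : Hist S.1.P j), Measurable ((W' S.1).mass j h))
    (hmt : ∀ S : Family L (eps0Of 𝔠.gamma0), ∀ (j : ℕ) (U : GaugeField S.1.P j (SU N)), 1 ≤ (W' S.1).mass j (Hist.triv S.1.P j) U)
    (hcap : ∀ S : Family L (eps0Of 𝔠.gamma0), ∀ k, 1 ≤ k → k ≤ S.1.K → ∀ (h : Hist S.1.P k) (U : GaugeField S.1.P k (SU N)),
      (W' S.1).mass k h U ≤ Real.exp (cm * S.1.sites k)) :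
    PrintedUV3G N L (runObjects₀A N (fun S => (X S).av)
      (fun S j => (Carriers.run3 ((({ (X S).toTowerBase 𝔠.lane.carrier with W := W' S } : TowerBaseAC S (SU N)).withSeriesAC (𝔖 S)
        (Carriers.piecesParamsOf S 𝔠.lane.carrier)).toRunInput fun _ => True)).T j)
      (Backgrounds.ofAvg N L fun S => (X S).av)) := by
  refine printedUV3G_of_analyticLeaves_towerAC3_of_window
    (fun S => (({ (X S).toTowerBase 𝔠.lane.carrier with W := W' S } : TowerBaseAC S (SU N)).withSeriesAC (𝔖 S) (Carriers.piecesParamsOf S 𝔠.lane.carrier)))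
    { eps0 := eps0Of 𝔠.gamma0,
      E := fun S => B10.Ek ((({ (X S).toTowerBase 𝔠.lane.carrier with W := W' S } : TowerBaseAC S (SU N)).withSeriesAC (𝔖 S)
        (Carriers.piecesParamsOf S 𝔠.lane.carrier)).Estep) S.K 0,
      b₀ := 𝔠.lane.F.b₀, p₀ := 𝔠.lane.F.p₀, εbg := εbg }
    (consts_adm_of_pos 𝔠 hpos _) (fun _ _ => rfl) (fun S k V => hUk S k V) (fun _ => rfl) hwin
    (C := { 𝔠.lane.consts with d := 𝔠.lane.consts.d + cm, d_nonneg := add_nonneg 𝔠.lane.consts.d_nonneg hcm }) 𝔠.lane.normalised (fun S => ?_)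
    (fun S => nonempty_analyticLeaves_reMassed_of_coreLTAtAC (le_of_eps0Of S.1 S.2) (W' S.1) _ rfl (hae S) (hdom S) (hWm S) (hmt S) hcm (hcap S) (R S))
  have u := usesConsts_reMassed (𝔠 := 𝔠) (X := X S.1) (𝔖 := 𝔖 S.1) (W' S.1) _ rfl (fun _ => True)
  exact ⟨u.M₁_eq, u.b₀_eq, u.p₀_eq, u.κ₀_eq, u.rcoef_eq, u.Λvol_nonneg⟩

/-! ## §2 The slot of record from the edition and the a.e. mass bound -/

/-- ★★★ **THE SLOT OF RECORD `Node00.PrintedUV3V N L` FROM THE EDITED (α)-AC ROWS AND A `dU`-a.e. EXTENSIVE MASS BOUND, `b₀p₀^{p₀}e^{1−p₀} ≤ εbg`** — AC inputs AT PRINT'S OWN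
AVERAGING pinned to the record, the (3.24) row as the printed sandwich `Eq324` at ANY letter `c S k` over the range-honest bundle `𝔄 S`, the mass bound «`massRecAC … (X S).av k h U ≤
exp(c_m|T₁^{(k)}|)` `dU_k`-a.e., `1 ≤ k ≤ K`» on the family; the re-massing `min (massRecAC) (e^{c_k})` chosen inside the proof (III-b §2 one (α)-currency lower).  NO E6′, no tilted
cgf-derivative bound, no all-steps binder, no pointwise RN-version statement. [cite: Balaban1985UV3, Thm 1 p.257 + Thm 2 p.272 + (41) p.266 + (7) p.257; Balaban1985Averaging, (15) p.19; Balaban1982Higgs1, (3.24) p.616] -/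
theorem printedUV3V_at_slotOfRecord_of_coreLTAtAC_of_massBoundAE_of_consts (hav : ∀ S, (X S).av = avOfPrint N S)
    (hUk : ∀ (S : Scales L) k (V : GaugeField S.P (k + 1) (SU N)), (X S).Uk k V = UkA N (fun S => (X S).av) S (k + 1) εbg V)
    (hε : 𝔠.lane.F.b₀ * (𝔠.lane.F.p₀ ^ 𝔠.lane.F.p₀ * Real.exp (1 - 𝔠.lane.F.p₀)) ≤ εbg)
    (R : ∀ S : Family L (eps0Of 𝔠.gamma0), RunAlphaEq324CoreLTAtAC 𝔊 𝔠 (X S.1) (𝔖 S.1) (𝔄 S.1) (c S.1)) (hcm : 0 ≤ cm)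
    (hmass : ∀ S : Family L (eps0Of 𝔠.gamma0), ∀ k, 1 ≤ k → k ≤ S.1.K → ∀ h : Hist S.1.P k, ∀ᵐ U ∂(fieldMeasure S.1.P k (SU N)),
      massRecAC 𝔠.lane.carrier.M₁ (rcolOf S.1 𝔠.lane.carrier) (eps1Of S.1 𝔠.lane.carrier) (epsSOf S.1 𝔠.lane.carrier) (X S.1).av k h U ≤ Real.exp (cm * S.1.sites k)) :
    Node00.PrintedUV3V N L := by
  classical
  -- the scale profile and the re-massing: `min (massRecAC) (e^{cs_k})`, `cs_0 = 0`, `cs_k = c_m|T₁^{(k)}|`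
  let cs : ∀ S : Scales L, ℕ → ℝ := fun S k => if k = 0 then 0 else cm * S.sites k
  have hc0 : ∀ S k, 0 ≤ cs S k := fun S k => by
    by_cases hk : k = 0
    · simp only [cs, if_pos hk]; exact le_rfl
    · simp only [cs, if_neg hk]; exact mul_nonneg hcm (sites_nonneg S k)
  let W' : ∀ S : Scales L, HistWeightsAC S.P (SU N) := fun S =>
    { mass := fun k h U => min (massRecAC 𝔠.lane.carrier.M₁ (rcolOf S 𝔠.lane.carrier) (eps1Of S 𝔠.lane.carrier) (epsSOf S 𝔠.lane.carrier) (X S).av k h U)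
        (Real.exp (cs S k))
      mass_nonneg := fun k h U => le_min (massRecAC_nonneg _ _ _ _ _ k h U) (Real.exp_pos _).le
      mass_zero := fun h U => by
        show min (massRecAC 𝔠.lane.carrier.M₁ (rcolOf S 𝔠.lane.carrier) (eps1Of S 𝔠.lane.carrier) (epsSOf S 𝔠.lane.carrier) (X S).av 0 h U)
          (Real.exp (cs S 0)) = 1
        rw [massRecAC_zero]
        simp only [cs, if_true, Real.exp_zero, min_self] }
  have hae : ∀ S : Family L (eps0Of 𝔠.gamma0), ∀ j, j ≤ S.1.K → ∀ h : Hist S.1.P j, (W' S.1).mass j h =ᵐ[fieldMeasure S.1.P j (SU N)]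
      massRecAC 𝔠.lane.carrier.M₁ (rcolOf S.1 𝔠.lane.carrier) (eps1Of S.1 𝔠.lane.carrier) (epsSOf S.1 𝔠.lane.carrier) (X S.1).av j h := by
    intro S j hj h
    by_cases hj0 : j = 0
    · subst hj0
      refine Filter.Eventually.of_forall fun U => ?_
      show min _ _ = _
      rw [massRecAC_zero]
      simp only [cs, if_true, Real.exp_zero, min_self]
    · have h1 : 1 ≤ j := Nat.one_le_iff_ne_zero.mpr hj0
      filter_upwards [hmass S j h1 hj h] with U hU
      show min _ _ = _
      simp only [cs, if_neg hj0]
      exact min_eq_left hU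
  have hdom : ∀ S : Family L (eps0Of 𝔠.gamma0), ∀ (j : ℕ) (h : Hist S.1.P j) (U : GaugeField S.1.P j (SU N)), (W' S.1).mass j h U ≤
      massRecAC 𝔠.lane.carrier.M₁ (rcolOf S.1 𝔠.lane.carrier) (eps1Of S.1 𝔠.lane.carrier) (epsSOf S.1 𝔠.lane.carrier) (X S.1).av j h U :=
    fun S j h U => min_le_left _ _
  have hWm : ∀ S : Family L (eps0Of 𝔠.gamma0), ∀ (j : ℕ) (h : Hist S.1.P j), Measurable ((W' S.1).mass j h) :=
    fun S j h => (measurable_massRecAC _ _ _ _ _ j h).min measurable_const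
  have hmt : ∀ S : Family L (eps0Of 𝔠.gamma0), ∀ (j : ℕ) (U : GaugeField S.1.P j (SU N)), 1 ≤ (W' S.1).mass j (Hist.triv S.1.P j) U :=
    fun S j U => le_min (one_le_massRecAC_triv _ _ _ _ _ j U) (Real.one_le_exp (hc0 S.1 j))
  have hcap : ∀ S : Family L (eps0Of 𝔠.gamma0), ∀ k, 1 ≤ k → k ≤ S.1.K → ∀ (h : Hist S.1.P k) (U : GaugeField S.1.P k (SU N)),
      (W' S.1).mass k h U ≤ Real.exp (cm * S.1.sites k) := by
    intro S k hk1 _ h U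
    have hk0 : k ≠ 0 := by omega
    calc (W' S.1).mass k h U ≤ Real.exp (cs S.1 k) := min_le_right _ _
      _ = Real.exp (cm * S.1.sites k) := by simp only [cs, if_neg hk0]
  obtain ⟨𝔗', h'⟩ := exists_TFamily₃_of_av_eq (N := N) (𝔞 := fun S => (X S).av) (funext hav)
    (fun S j => (Carriers.run3 ((({ (X S).toTowerBase 𝔠.lane.carrier with W := W' S } : TowerBaseAC S (SU N)).withSeriesAC (𝔖 S)
      (Carriers.piecesParamsOf S 𝔠.lane.carrier)).toRunInput fun _ => True)).T j)
  have hR : runObjects₀A N (fun S => (X S).av)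
      (fun S j => (Carriers.run3 ((({ (X S).toTowerBase 𝔠.lane.carrier with W := W' S } : TowerBaseAC S (SU N)).withSeriesAC (𝔖 S)
        (Carriers.piecesParamsOf S 𝔠.lane.carrier)).toRunInput fun _ => True)).T j)
      (Backgrounds.ofAvg N L fun S => (X S).av) = runObjects₀T N 𝔗' (Backgrounds.ofPrint N L) :=
    funext fun c' => funext fun S => h' c' S
  exact ⟨𝔗', hR ▸ printedUV3G_at_record_of_coreLTAtAC_of_reMassed_of_window (𝔄 := 𝔄) (c := c) W' hUk (pos_of_famConsts hε)
    (fun S => window_of_famConsts hε _ S.1) R hcm hae hdom hWm hmt hcap⟩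

variable (N L) in
/-- ★★★ **THE SLOT OF RECORD FROM ITS EDITED AC RESIDUALS WITH THE MASS BOUND `dU`-a.e. ON PRINT'S OWN MASSES — A6 FORM** (file 9 §2's inhabitant: AC external inputs AT PRINT'S AVERAGING
with the record's classes and minimisers EXIST): for every `SU(N)`, `𝔠`, `εbg` with `b₀p₀^{p₀}e^{1−p₀} ≤ εbg`, `c_m ≥ 0`, THERE ARE such inputs `X`, and for every expansion data `𝔖`,
range-honest (α)-AC data `𝔄` and cumulant letter `c` (e.g. the free Gaussian moment-cumulants a [BenfattoEtAl1978]∕class sandwich supplier speaks), **the EDITED (α)-AC rows on the family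
∧ «`massRecAC … (avOfPrint N S) k h ≤ exp(c_m|T₁^{(k)}|)` `dU_k`-a.e., `1 ≤ k ≤ K`» ⇒ `Node00.PrintedUV3V N L`**. [cite: Balaban1985UV3, Thm 1 p.257 + Thm 2 p.272 + (41) p.266; Balaban1985Averaging, (15) p.19; Balaban1982Higgs1, (3.24) p.616] -/
theorem printedUV3V_at_slotOfRecord_of_coreLTAtAC_of_massBoundAE_of_consts' (𝔊 : GroupModel (SU N)) (𝔠 : Primitives.AlphaConsts L 𝔊.N) (εbg cm : ℝ)
    (hε : 𝔠.lane.F.b₀ * (𝔠.lane.F.p₀ ^ 𝔠.lane.F.p₀ * Real.exp (1 - 𝔠.lane.F.p₀)) ≤ εbg) (hcm : 0 ≤ cm) :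
    ∃ X : ∀ S : Scales L, ExternalInputsAC S (SU N), (∀ S, (X S).av = avOfPrint N S) ∧
      ∀ (𝔖 : ∀ (S : Scales L) (k : ℕ), StepSeries S (SU N) ↥(lieC 𝔊) (nblkOf S 𝔠.lane.carrier k) k)
        (𝔄 : ∀ S : Scales L, AlphaDataLTAC 𝔊 𝔠 (X S) (𝔖 S))
        (c : ∀ (S : Scales L) (k : ℕ), Hist S.P (k + 1) → GaugeField S.P (k + 1) (SU N) → ℕ → ℝ),
        (∀ S : Family L (eps0Of 𝔠.gamma0), RunAlphaEq324CoreLTAtAC 𝔊 𝔠 (X S.1) (𝔖 S.1) (𝔄 S.1) (c S.1)) →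
        (∀ S : Family L (eps0Of 𝔠.gamma0), ∀ k, 1 ≤ k → k ≤ S.1.K → ∀ h : Hist S.1.P k, ∀ᵐ U ∂(fieldMeasure S.1.P k (SU N)),
          massRecAC 𝔠.lane.carrier.M₁ (rcolOf S.1 𝔠.lane.carrier) (eps1Of S.1 𝔠.lane.carrier) (epsSOf S.1 𝔠.lane.carrier) (avOfPrint N S.1) k h U ≤
            Real.exp (cm * S.1.sites k)) →
        Node00.PrintedUV3V N L := by
  obtain ⟨X, hav, -, hUk⟩ := exists_externalInputsAC_ofPrint N L εbg
  refine ⟨X, hav, fun 𝔖 𝔄 c R hmass =>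
    printedUV3V_at_slotOfRecord_of_coreLTAtAC_of_massBoundAE_of_consts (𝔄 := 𝔄) (c := c) hav hUk hε R hcm fun S k hk1 hkK h => ?_⟩
  have hX : (X S.1).av = avOfPrint N S.1 := hav S.1
  rw [hX]
  exact hmass S k hk1 hkK h

variable (N L) in
/-- ★★★ **THE SLOT OF RECORD FROM THE EDITED (α)-AC ROWS AND A DENSITY BOUND ON ANY WEAKLY-CLOSED FAMILY AT PRINT'S AVERAGING — A6 FORM** (composed with dag-n08-w1's file 17 §3
`massRecAC_le_exp_ae_of_weakClosed`: `(dU_k + ν_k)∘Ū_k⁻¹ ≤ dU_{k+1} + ν_{k+1}` for `k < K` and `ν_k ≤ (e^{c_m|T₁^{(k)}|} − 1)·dU_k` for `k ≤ K` give the a.e. mass bound; the least such family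
is their `ν♯`).  The weakest typed form of N08's residual on the road of record. [cite: Balaban1985UV3, Thm 1 p.257 + Thm 2 p.272 + (41) p.266; Balaban1985Averaging, (15) p.19] -/
theorem printedUV3V_at_slotOfRecord_of_coreLTAtAC_of_weakClosed_of_consts' (𝔊 : GroupModel (SU N)) (𝔠 : Primitives.AlphaConsts L 𝔊.N) (εbg cm : ℝ)
    (hε : 𝔠.lane.F.b₀ * (𝔠.lane.F.p₀ ^ 𝔠.lane.F.p₀ * Real.exp (1 - 𝔠.lane.F.p₀)) ≤ εbg) (hcm : 0 ≤ cm) :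
    ∃ X : ∀ S : Scales L, ExternalInputsAC S (SU N), (∀ S, (X S).av = avOfPrint N S) ∧
      ∀ (𝔖 : ∀ (S : Scales L) (k : ℕ), StepSeries S (SU N) ↥(lieC 𝔊) (nblkOf S 𝔠.lane.carrier k) k)
        (𝔄 : ∀ S : Scales L, AlphaDataLTAC 𝔊 𝔠 (X S) (𝔖 S))
        (c : ∀ (S : Scales L) (k : ℕ), Hist S.P (k + 1) → GaugeField S.P (k + 1) (SU N) → ℕ → ℝ),
        (∀ S : Family L (eps0Of 𝔠.gamma0), RunAlphaEq324CoreLTAtAC 𝔊 𝔠 (X S.1) (𝔖 S.1) (𝔄 S.1) (c S.1)) →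
        (∀ S : Family L (eps0Of 𝔠.gamma0), ∃ ν : ∀ k, Measure (GaugeField S.1.P k (SU N)),
          (∀ k, k < S.1.K → (fieldMeasure S.1.P k (SU N) + ν k).map (avOfPrint N S.1 k).avg ≤ fieldMeasure S.1.P (k + 1) (SU N) + ν (k + 1)) ∧
          (∀ k, k ≤ S.1.K → ν k ≤ ENNReal.ofReal (Real.exp (cm * S.1.sites k) - 1) • fieldMeasure S.1.P k (SU N))) →
        Node00.PrintedUV3V N L := by
  obtain ⟨X, hav, h⟩ := printedUV3V_at_slotOfRecord_of_coreLTAtAC_of_massBoundAE_of_consts' N L 𝔊 𝔠 εbg cm hε hcm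
  refine ⟨X, hav, fun 𝔖 𝔄 c R hν => h 𝔖 𝔄 c R fun S k hk1 hkK hh => ?_⟩
  obtain ⟨ν, hstep, hνc⟩ := hν S
  exact massRecAC_le_exp_ae_of_weakClosed 𝔠.lane.carrier.M₁ (rcolOf S.1 𝔠.lane.carrier) (eps1Of S.1 𝔠.lane.carrier) (epsSOf S.1 𝔠.lane.carrier) (avOfPrint N S.1)
    (avgAC_avOfPrint N L S.1) S.1.K ν hstep (fun k => cm * S.1.sites k) (fun k => mul_nonneg hcm (sites_nonneg S.1 k)) hνc k hkK hh

/-! ## §3 III-b's RunAlphaAC form is the χ-letter instance -/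

/-- ★ **… AND dag-n08-w1's III-b §2 IS THE χ-LETTER INSTANCE**: from `RunAlphaAC` on the family the slot follows through p607065's `coreLTAtAC_cum_of_runAlphaAC` (edition at the lane's
letter `(𝔖 S ·).cum` over `restrictLTAC`) — the edition loses nothing along the re-massed road. [cite: Balaban1985UV3, Thm 1 p.257 + Thm 2 p.272 (bookkeeping)] -/
theorem printedUV3V_at_slotOfRecord_of_alphaAC_of_massBoundAE_of_consts_via_eq324 {𝔄' : ∀ S : Scales L, AlphaDataAC 𝔊 𝔠 (X S) (𝔖 S)}
    (hav : ∀ S, (X S).av = avOfPrint N S)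
    (hUk : ∀ (S : Scales L) k (V : GaugeField S.P (k + 1) (SU N)), (X S).Uk k V = UkA N (fun S => (X S).av) S (k + 1) εbg V)
    (hε : 𝔠.lane.F.b₀ * (𝔠.lane.F.p₀ ^ 𝔠.lane.F.p₀ * Real.exp (1 - 𝔠.lane.F.p₀)) ≤ εbg)
    (R : ∀ S : Family L (eps0Of 𝔠.gamma0), RunAlphaAC 𝔊 𝔠 (X S.1) (𝔖 S.1) (𝔄' S.1)) (hcm : 0 ≤ cm)
    (hmass : ∀ S : Family L (eps0Of 𝔠.gamma0), ∀ k, 1 ≤ k → k ≤ S.1.K → ∀ h : Hist S.1.P k, ∀ᵐ U ∂(fieldMeasure S.1.P k (SU N)),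
      massRecAC 𝔠.lane.carrier.M₁ (rcolOf S.1 𝔠.lane.carrier) (eps1Of S.1 𝔠.lane.carrier) (epsSOf S.1 𝔠.lane.carrier) (X S.1).av k h U ≤ Real.exp (cm * S.1.sites k)) :
    Node00.PrintedUV3V N L :=
  printedUV3V_at_slotOfRecord_of_coreLTAtAC_of_massBoundAE_of_consts (𝔄 := fun S => restrictLTAC (𝔄' S)) (c := fun S k => (𝔖 S k).cum) hav hUk hε
    (fun S => coreLTAtAC_cum_of_runAlphaAC (R S)) hcm hmass

end Summit.QuantumFields.YangMills.Theorems.BalabanUVNodesN08AlphaEq324RowACReMassedSlotOfRecord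

end
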